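import Summits.BirchSwinnertonDyer.BirchSwinnertonDyer.Theorems.AlignedTransportAtTwoMainConjectureTransportAlignedAtTwoKilfordCopyCrossLevelSquarefreePairs
import Summits.BirchSwinnertonDyer.BirchSwinnertonDyer.Theorems.AlignedTransportAtTwoMainConjectureTransportAlignedAtTwoKilfordCopyCrossLevel
import HarnessLib

/-!
# Crux C1 `MainConjectureTransportAlignedAtTwo` (stmt-BirchSwinnertonDyer-22296), line `birth`, residual (R2) `stub_lamLawKilford`, UNEQUAL conductors:
# THE INTERMEDIATE-LEVEL REDUCTION, TWO-SIDED SQUAREFREE SHAPE `N₁ = N₀·m₁`, `N₂ = N₀·m₂` (`m₁, m₂` squarefree, coprime, `mᵢ` prime to `N_j`) —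
# e.g. EVERY pair of semistable curves (`N₀ = gcd`): BOTH newforms absorbed into old lines at the common level `L = N₀m₁m₂` (abstract lattices)
# (width seat att-p3 g18; `--supports 22296`)

THEOREMS ONLY (no `def`, no `sorry`, no named fact). Sequel of `…KilfordCopyCrossLevelSquarefree(Pairs)` (`oldLines_absorb`, `modularSymbol_oldLines`) applied on
BOTH sides with ONE integer operator (Euler data of `f₁` on `Q₁`, of `f₂` elsewhere, `E' = 𝟙_{ℓ ∤ L}`). Pure period bookkeeping; BSD is not proved by this;
C1 is not closed by this; the cross-level input of (R2) is REDUCED (for this shape) to «same half-kernel at the common level `L` of `(c₁·y(F₁), c₂·y(F₂))`»,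
`F₁` the `m₂`-old line of `f₁` and `F₂` the `m₁`-old line of `f₂` (PLANE(2) at level `L` for the two old planes; att-p5 g18's fourth engine: lcm-type rows
aligned ⟹ same plane 2/2, misaligned ⟹ planes meet in 0 7/7; composite `m` 7/7 + 15/15). The crux-currency version and the `hCopyNe`-body wrapper are in
the sequel `…KilfordCopyCrossLevelSemistable`.

* §1 **`sameKernel_depleted_of_sameKernel_twoOldLinesSets`** (abstract lattices; parities: for `q ∈ Q₂`, `a_q(f₁)` even and `a_q(f₂)` odd; for
  `q ∈ Q₁`, `a_q(f₂)` even and `a_q(f₁)` odd; `a_ℓ(f₁) ≡ a_ℓ(f₂)` on `S ∖ (Q₁ ∪ Q₂)`).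
* §2 `two_dvd_LFunction_sub_of_conductorNorm_eq_mul_mul` — same reduction type at `ℓ ∣ N₀` prime to `m₁m₂` when `N(Wᵢ) = N₀·mᵢ`.
* §3 `exists_semistableShape` — two squarefree levels always have this shape (`N₀ = gcd`, `Qᵢ` = primes of `Nᵢ/N₀`).

References: Greenberg–Vatsal 2000 §3 [GreenbergVatsal2000]; Cremona 1997 §2.4, §2.10 [CremonaAlgorithms1997]; Silverman ATAEC IV.10.2 [Silverman1994].
-/

noncomputable section

-- justification: the `Summit.BirchSwinnertonDyer.BirchSwinnertonDyer.…` path repeats a component (route-file convention)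
set_option linter.dupNamespace false
set_option autoImplicit false

open scoped MatrixGroups ModularForm Classical

open CongruenceSubgroup Complex WeierstrassCurve IsDedekindDomain
open Literature.NumberTheory.EllipticCurves Literature.NumberTheory.EllipticCurves.ModularForms
open Summit.BirchSwinnertonDyer.BirchSwinnertonDyer.Theorems.AlignedTransportAtTwoDeltaPosCongruenceInputs (odd_LFunction_iff_hasMultiplicativeReductionAtPrime)
open Summit.BirchSwinnertonDyer.BirchSwinnertonDyer.Theorems.AlignedTransportAtTwoKilfordCopyCrossLevelTools
open Summit.BirchSwinnertonDyer.BirchSwinnertonDyer.Theorems.AlignedTransportAtTwoKilfordCopyCrossLevelSquarefree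
open Summit.BirchSwinnertonDyer.BirchSwinnertonDyer.Theorems.AlignedTransportAtTwoKilfordCopyCrossLevelSquarefreePairs

namespace Summit.BirchSwinnertonDyer.BirchSwinnertonDyer.Theorems.AlignedTransportAtTwoKilfordCopyCrossLevelTwoSided

/-! ## §1 Both sides absorbed: `L = N₁·∏Q₂ = N₂·∏Q₁` -/

/-- **Cross-level same-kernel from the common level, TWO-SIDED squarefree shape (abstract lattices).** `fᵢ ∈ S₂(Γ₀(Nᵢ))` Hecke eigenforms with
integer coefficients `Aᵢ`; disjoint sets of primes `Q₁` (not dividing `N₂`) and `Q₂` (not dividing `N₁`) with a common level `L = N₁·∏Q₂ = N₂·∏Q₁`; parities: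
`a_q(f₁)` even and `a_q(f₂)` odd for `q ∈ Q₂`, `a_q(f₂)` even and `a_q(f₁)` odd for `q ∈ Q₁`; `S ⊇ Q₁ ∪ Q₂` odd primes with `a_ℓ(f₁) ≡ a_ℓ(f₂)` off
`Q₁ ∪ Q₂`; `gᵢ` the `S`-depleted forms at `N'` with `L∏ℓ² ∣ N'`; `F₁` the `Q₂`-old line of `f₁` and `F₂` the `Q₁`-old line
of `f₂` at level `L`; `Λᵢ ⊇ cᵢΛ_{fᵢ}`. IF the half-kernels of `y ↦ cᵢ·y(Fᵢ)` on `H₁(X₀(L);ℤ)` agree THEN the depleted half-kernels agree.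
[cite: GreenbergVatsal2000, §3] [cite: EmertonPollackWeston2006, §3 (3.4)–(3.5)] [cite: CremonaAlgorithms1997, §2.4] -/
theorem sameKernel_depleted_of_sameKernel_twoOldLinesSets
    {N₁ N₂ L : ℕ} [NeZero N₁] [NeZero N₂] [NeZero L] (Q₁ Q₂ : Finset ℕ)
    (hQ₁ : ∀ q ∈ Q₁, q.Prime) (hQ₂ : ∀ q ∈ Q₂, q.Prime) (hdisj : Disjoint Q₁ Q₂)
    (hQ₁N₂ : ∀ q ∈ Q₁, ¬ q ∣ N₂) (hQ₂N₁ : ∀ q ∈ Q₂, ¬ q ∣ N₁)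
    (hL₁ : L = N₁ * ∏ q ∈ Q₂, q) (hL₂ : L = N₂ * ∏ q ∈ Q₁, q)
    (f₁ : CuspForm (Gamma0 N₁) 2) (f₂ : CuspForm (Gamma0 N₂) 2)
    (A₁ A₂ : ℕ → ℤ) (hA₁ : ∀ n, cuspCoeff f₁ n = A₁ n) (hA₂ : ∀ n, cuspCoeff f₂ n = A₂ n)
    (hT₁ : ∀ (p : ℕ) (hp : p.Prime), (haveI : NeZero p := ⟨hp.ne_zero⟩; heckeT (Gamma0 N₁) 2 p f₁) = cuspCoeff f₁ p • f₁)
    (hT₂ : ∀ (p : ℕ) (hp : p.Prime), (haveI : NeZero p := ⟨hp.ne_zero⟩; heckeT (Gamma0 N₂) 2 p f₂) = cuspCoeff f₂ p • f₂)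
    (h₁₂ : ∀ q ∈ Q₂, Even (A₁ q)) (h₂₂ : ∀ q ∈ Q₂, Odd (A₂ q)) (h₂₁ : ∀ q ∈ Q₁, Even (A₂ q)) (h₁₁ : ∀ q ∈ Q₁, Odd (A₁ q))
    (S : Finset ℕ) (hS : ∀ ℓ ∈ S, ℓ.Prime) (hSodd : ∀ ℓ ∈ S, Odd ℓ) (hQ₁S : Q₁ ⊆ S) (hQ₂S : Q₂ ⊆ S)
    (hAS : ∀ ℓ ∈ S, ℓ ∉ Q₁ → ℓ ∉ Q₂ → (2 : ℤ) ∣ A₁ ℓ - A₂ ℓ)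
    (N' : ℕ) [NeZero N'] (hN' : L * ∏ ℓ ∈ S, ℓ ^ 2 ∣ N')
    (g₁ g₂ : CuspForm (Gamma0 N') 2)
    (hg₁ : ∀ n, cuspCoeff g₁ n = if ∃ ℓ ∈ S, ℓ ∣ n then 0 else cuspCoeff f₁ n)
    (hg₂ : ∀ n, cuspCoeff g₂ n = if ∃ ℓ ∈ S, ℓ ∣ n then 0 else cuspCoeff f₂ n)
    (F₁ F₂ : CuspForm (Gamma0 L) 2)
    (hF₁ : ∀ n : ℕ, cuspCoeff F₁ n =
      ∑ T ∈ Q₂.powerset, ((∏ q ∈ T, q : ℕ) : ℂ) * (if (∏ q ∈ T, q) ∣ n then cuspCoeff f₁ (n / ∏ q ∈ T, q) else 0))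
    (hF₂ : ∀ n : ℕ, cuspCoeff F₂ n =
      ∑ T ∈ Q₁.powerset, ((∏ q ∈ T, q : ℕ) : ℂ) * (if (∏ q ∈ T, q) ∣ n then cuspCoeff f₂ (n / ∏ q ∈ T, q) else 0))
    (Λ₁ Λ₂ : AddSubgroup ℂ) (c₁ c₂ : ℂ)
    (hc₁ : ∀ z ∈ periodLattice f₁, c₁ * z ∈ Λ₁) (hc₂ : ∀ z ∈ periodLattice f₂, c₂ * z ∈ Λ₂)
    (hker : ∀ y ∈ periodHomology L, c₁ * y F₁ / 2 ∈ Λ₁ ↔ c₂ * y F₂ / 2 ∈ Λ₂) :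
    ∀ x ∈ periodHomology N',
      c₁ * (((∏ ℓ ∈ S, ℓ ^ 2 : ℕ) : ℂ) * x g₁) / 2 ∈ Λ₁ ↔ c₂ * (((∏ ℓ ∈ S, ℓ ^ 2 : ℕ) : ℂ) * x g₂) / 2 ∈ Λ₂ := by
  classical
  intro x hx
  have hM0 : (∏ ℓ ∈ S, ℓ ^ 2) ≠ 0 := Finset.prod_ne_zero_iff.mpr fun ℓ hℓ ↦ pow_ne_zero 2 (hS ℓ hℓ).ne_zero
  have hQ₁0 : ∀ q ∈ Q₁, q ≠ 0 := fun q hq ↦ (hQ₁ q hq).ne_zero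
  have hQ₂0 : ∀ q ∈ Q₂, q ≠ 0 := fun q hq ↦ (hQ₂ q hq).ne_zero
  have hN₁L : N₁ * ∏ q ∈ Q₂, q ∣ L := by rw [hL₁]
  have hN₂L : N₂ * ∏ q ∈ Q₁, q ∣ L := by rw [hL₂]
  -- `x` is the period functional of one `γ ∈ Γ₀(N')`
  have hx' : x ∈ (periodHomology N' : Set (Module.Dual ℂ (CuspForm (Gamma0 N') 2))) := hx
  rw [coe_periodHomology_eq_range] at hx'
  obtain ⟨γ, rfl⟩ := hx'
  simp only [periodFunctional_apply]
  by_cases hγ : (γ : SL(2, ℤ)) 1 0 = 0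
  · simp only [cuspSymbol, if_pos hγ, mul_zero, zero_div, Λ₁.zero_mem, Λ₂.zero_mem]
  set r : ℚ := (((γ : SL(2, ℤ)) 0 0 : ℚ) / ((γ : SL(2, ℤ)) 1 0 : ℚ)) with hr
  have hcusp : ∀ g : CuspForm (Gamma0 N') 2, cuspSymbol g γ = modularSymbol g r := fun g ↦ by
    rw [cuspSymbol, if_neg hγ]
  rw [hcusp, hcusp]
  -- elementary divisibilities
  have hdvdQ : ∀ (Q : Finset ℕ), (∀ q ∈ Q, q.Prime) → ∀ ℓ : ℕ, ℓ.Prime → ℓ ∉ Q → ¬ ℓ ∣ ∏ q ∈ Q, q := by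
    intro Q hQ ℓ hℓ hℓQ h
    obtain ⟨q, hq, hℓq⟩ := (Prime.dvd_finsetProd_iff hℓ.prime _).mp h
    exact hℓQ (((Nat.prime_dvd_prime_iff_eq hℓ (hQ q hq)).mp hℓq) ▸ hq)
  have hdivL : ∀ (N : ℕ) (Q : Finset ℕ), (∀ q ∈ Q, q.Prime) → L = N * ∏ q ∈ Q, q → ∀ ℓ : ℕ, ℓ.Prime → ℓ ∉ Q → (ℓ ∣ N ↔ ℓ ∣ L) := by
    intro N Q hQ hLN ℓ hℓ hℓQ
    rw [hLN]
    refine ⟨fun h ↦ h.mul_right _, fun h ↦ ?_⟩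
    rcases (Nat.Prime.dvd_mul hℓ).mp h with h | h
    · exact h
    · exact absurd h (hdvdQ Q hQ ℓ hℓ hℓQ)
  have hQ₁L : ∀ q ∈ Q₁, q ∣ L := fun q hq ↦ by rw [hL₂]; exact (Finset.dvd_prod_of_mem _ hq).mul_left N₂
  have hQ₂L : ∀ q ∈ Q₂, q ∣ L := fun q hq ↦ by rw [hL₁]; exact (Finset.dvd_prod_of_mem _ hq).mul_left N₁
  -- ONE integer operator: `B'` = data of `f₁` on `Q₁`, of `f₂` elsewhere; `E' = 𝟙_{ℓ ∤ L}`
  -- side 1: absorb `Q₂`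
  have hB₁ : ∀ ℓ ∈ S, ℓ ∉ Q₂ → (2 : ℤ) ∣ -A₁ ℓ - (if ℓ ∈ Q₁ then -A₁ ℓ else -A₂ ℓ) := by
    intro ℓ hℓ h2
    by_cases h1 : ℓ ∈ Q₁
    · rw [if_pos h1, sub_self]; exact dvd_zero 2
    · rw [if_neg h1, show -A₁ ℓ - -A₂ ℓ = -(A₁ ℓ - A₂ ℓ) by ring]
      exact (hAS ℓ hℓ h1 h2).neg_right
  have hE₁ : ∀ ℓ ∈ S, ℓ ∉ Q₂ → (2 : ℤ) ∣ (if ℓ ∣ N₁ then 0 else 1) - (if ℓ ∣ L then 0 else 1 : ℤ) := by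
    intro ℓ hℓ h2
    have hiff := hdivL N₁ Q₂ hQ₂ hL₁ ℓ (hS ℓ hℓ) h2
    by_cases hN : ℓ ∣ N₁
    · rw [if_pos hN, if_pos (hiff.mp hN), sub_self]; exact dvd_zero 2
    · rw [if_neg hN, if_neg (fun h ↦ hN (hiff.mpr h)), sub_self]; exact dvd_zero 2
  have hE₂ : ∀ ℓ ∈ S, ℓ ∉ Q₁ → (2 : ℤ) ∣ (if ℓ ∣ N₂ then 0 else 1) - (if ℓ ∣ L then 0 else 1 : ℤ) := by
    intro ℓ hℓ h1
    have hiff := hdivL N₂ Q₁ hQ₁ hL₂ ℓ (hS ℓ hℓ) h1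
    by_cases hN : ℓ ∣ N₂
    · rw [if_pos hN, if_pos (hiff.mp hN), sub_self]; exact dvd_zero 2
    · rw [if_neg hN, if_neg (fun h ↦ hN (hiff.mpr h)), sub_self]; exact dvd_zero 2
  have hB₂ : ∀ ℓ ∈ S, ℓ ∉ Q₁ → (2 : ℤ) ∣ -A₂ ℓ - (if ℓ ∈ Q₁ then -A₁ ℓ else -A₂ ℓ) := by
    intro ℓ _ h1
    rw [if_neg h1, sub_self]; exact dvd_zero 2
  have hBQ₂ : ∀ q ∈ Q₂, Odd ((fun ℓ ↦ if ℓ ∈ Q₁ then -A₁ ℓ else -A₂ ℓ) q) := fun q hq ↦ by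
    show Odd (if q ∈ Q₁ then -A₁ q else -A₂ q)
    rw [if_neg (Finset.disjoint_right.mp hdisj hq)]; exact (h₂₂ q hq).neg
  have hBQ₁ : ∀ q ∈ Q₁, Odd ((fun ℓ ↦ if ℓ ∈ Q₁ then -A₁ ℓ else -A₂ ℓ) q) := fun q hq ↦ by
    show Odd (if q ∈ Q₁ then -A₁ q else -A₂ q)
    rw [if_pos hq]; exact (h₁₁ q hq).neg
  have hEQ₂ : ∀ q ∈ Q₂, (fun ℓ ↦ if ℓ ∣ L then (0 : ℤ) else 1) q = 0 := fun q hq ↦ by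
    show (if q ∣ L then (0 : ℤ) else 1) = 0
    rw [if_pos (hQ₂L q hq)]
  have hEQ₁ : ∀ q ∈ Q₁, (fun ℓ ↦ if ℓ ∣ L then (0 : ℤ) else 1) q = 0 := fun q hq ↦ by
    show (if q ∣ L then (0 : ℤ) else 1) = 0
    rw [if_pos (hQ₁L q hq)]
  obtain ⟨z₁, hz₁, e₁⟩ := oldLines_absorb f₁ A₁ hA₁ hT₁ S hS hSodd N' Λ₁ c₁ hc₁ g₁ hg₁ γ hγ Q₂ hQ₂S hQ₂N₁ h₁₂
    (by rw [← hL₁]; exact hN') (fun ℓ ↦ if ℓ ∈ Q₁ then -A₁ ℓ else -A₂ ℓ) (fun ℓ ↦ if ℓ ∣ L then 0 else 1) hB₁ hE₁ hBQ₂ hEQ₂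
  obtain ⟨z₂, hz₂, e₂⟩ := oldLines_absorb f₂ A₂ hA₂ hT₂ S hS hSodd N' Λ₂ c₂ hc₂ g₂ hg₂ γ hγ Q₁ hQ₁S hQ₁N₂ h₂₁
    (by rw [← hL₂]; exact hN') (fun ℓ ↦ if ℓ ∈ Q₁ then -A₁ ℓ else -A₂ ℓ) (fun ℓ ↦ if ℓ ∣ L then 0 else 1) hB₂ hE₂ hBQ₁ hEQ₁
  -- ONE cycle `y ∈ H₁(X₀(L);ℤ)` computing the common operator on every form of level `L`
  obtain ⟨y, hy, hyH⟩ := exists_mem_periodHomology_apply_eq_act L (fun ℓ ↦ if ℓ ∈ Q₁ then -A₁ ℓ else -A₂ ℓ)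
    (fun ℓ ↦ if ℓ ∣ L then 0 else 1) S r (fun m hm ↦
      exists_gamma0_dilate_cusp (ne_zero_of_dvd_ne_zero hM0 hm) ((mul_dvd_mul_left _ hm).trans hN') γ hγ)
  have E1 : c₁ * (((∏ ℓ ∈ S, ℓ ^ 2 : ℕ) : ℂ) * modularSymbol g₁ r) = c₁ * y F₁ + 2 * z₁ := by
    rw [hyH F₁]
    simp only [modularSymbol_oldLines Q₂ hQ₂0 hN₁L f₁ F₁ hF₁]
    exact e₁
  have E2 : c₂ * (((∏ ℓ ∈ S, ℓ ^ 2 : ℕ) : ℂ) * modularSymbol g₂ r) = c₂ * y F₂ + 2 * z₂ := by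
    rw [hyH F₂]
    simp only [modularSymbol_oldLines Q₁ hQ₁0 hN₂L f₂ F₂ hF₂]
    exact e₂
  rw [div_two_mem_iff_of_eq_add Λ₁ hz₁ E1, div_two_mem_iff_of_eq_add Λ₂ hz₂ E2]
  exact hker y hy

/-! ## §2 Same reduction type at the common primes -/

/-- **Same reduction type at `ℓ ∣ N₀` prime to `m₁ m₂`, when `N(W₁) = N₀·m₁`, `N(W₂) = N₀·m₂`**: `a_ℓ(W₁) ≡ a_ℓ(W₂) (mod 2)`.
[cite: Silverman1994, IV.10.2] -/
theorem two_dvd_LFunction_sub_of_conductorNorm_eq_mul_mul (W₁ W₂ : WeierstrassCurve ℚ) [W₁.IsElliptic] [W₂.IsElliptic] {N₀ m₁ m₂ : ℕ}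
    (hN₁ : W₁.conductorNorm ℤ = N₀ * m₁) (hN₂ : W₂.conductorNorm ℤ = N₀ * m₂) {ℓ : ℕ} (hℓ : ℓ.Prime) (hℓm₁ : ¬ ℓ ∣ m₁) (hℓm₂ : ¬ ℓ ∣ m₂)
    (hℓN : ℓ ∣ N₀) : (2 : ℤ) ∣ W₁.LFunction ℓ - W₂.LFunction ℓ := by
  haveI : Fact ℓ.Prime := ⟨hℓ⟩
  have hℓN₁ : ℓ ∣ W₁.conductorNorm ℤ := by rw [hN₁]; exact hℓN.mul_right m₁
  have hℓN₂ : ℓ ∣ W₂.conductorNorm ℤ := by rw [hN₂]; exact hℓN.mul_right m₂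
  have hcop₁ : Nat.Coprime (ℓ ^ 2) m₁ := ((Nat.Prime.coprime_iff_not_dvd hℓ).mpr hℓm₁).pow_left 2
  have hcop₂ : Nat.Coprime (ℓ ^ 2) m₂ := ((Nat.Prime.coprime_iff_not_dvd hℓ).mpr hℓm₂).pow_left 2
  set v : HeightOneSpectrum ℤ := (Rat.HeightOneSpectrum.primesEquiv (R := ℤ)).symm ⟨ℓ, hℓ⟩ with hv
  have hgen : Rat.HeightOneSpectrum.natGenerator v = ℓ :=
    congrArg Subtype.val ((Rat.HeightOneSpectrum.primesEquiv (R := ℤ)).apply_symm_apply ⟨ℓ, hℓ⟩)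
  have hbad₁ : ¬ W₁.HasGoodReductionAt v := (natGenerator_dvd_conductorNorm_iff v W₁).mp (hgen ▸ hℓN₁)
  have hbad₂ : ¬ W₂.HasGoodReductionAt v := (natGenerator_dvd_conductorNorm_iff v W₂).mp (hgen ▸ hℓN₂)
  have hadd : W₁.HasAdditiveReductionAt v ↔ W₂.HasAdditiveReductionAt v := by
    rw [← natGenerator_sq_dvd_conductorNorm_iff v W₁, ← natGenerator_sq_dvd_conductorNorm_iff v W₂, hN₁, hN₂, hgen]
    exact ⟨fun h ↦ (hcop₁.dvd_of_dvd_mul_right h).mul_right m₂, fun h ↦ (hcop₂.dvd_of_dvd_mul_right h).mul_right m₁⟩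
  have hmul : W₁.HasMultiplicativeReductionAtPrime ℓ ↔ W₂.HasMultiplicativeReductionAtPrime ℓ := by
    rw [W₁.hasMultiplicativeReductionAtPrime_iff_hasMultiplicativeReductionAt_holds ⟨ℓ, hℓ⟩,
      W₂.hasMultiplicativeReductionAtPrime_iff_hasMultiplicativeReductionAt_holds ⟨ℓ, hℓ⟩]
    constructor
    · intro h₁
      rcases hasGoodReductionAt_or_hasMultiplicativeReductionAt_or_hasAdditiveReductionAt v W₂ with h | h | h
      · exact (hbad₂ h).elim
      · exact h
      · exact (h₁.not_hasAdditiveReductionAt (hadd.mpr h)).elim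
    · intro h₂
      rcases hasGoodReductionAt_or_hasMultiplicativeReductionAt_or_hasAdditiveReductionAt v W₁ with h | h | h
      · exact (hbad₁ h).elim
      · exact h
      · exact (h₂.not_hasAdditiveReductionAt (hadd.mp h)).elim
  have h₁ := odd_LFunction_iff_hasMultiplicativeReductionAtPrime W₁ hℓ hℓN₁
  have h₂ := odd_LFunction_iff_hasMultiplicativeReductionAtPrime W₂ hℓ hℓN₂
  have heven : Even (W₁.LFunction ℓ - W₂.LFunction ℓ) := by
    rw [Int.even_sub, ← Int.not_odd_iff_even, ← Int.not_odd_iff_even, h₁, h₂, hmul]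
  exact heven.two_dvd

/-! ## §3 Every pair of squarefree levels has the two-sided shape -/

/-- **Two squarefree levels `N₁, N₂` always have the two-sided shape**: `N₁ = N₀·∏Q₁`, `N₂ = N₀·∏Q₂` with `N₀ = gcd(N₁, N₂)`, `Qᵢ` the primes of `Nᵢ/N₀`,
`Q₁, Q₂` disjoint and prime to `N₀`. (So the two-sided reduction applies to every pair of semistable curves.) [cite: CremonaAlgorithms1997, §2.10] -/
theorem exists_semistableShape {N₁ N₂ : ℕ} (hN₁ : Squarefree N₁) (hN₂ : Squarefree N₂) :
    ∃ (N₀ : ℕ) (Q₁ Q₂ : Finset ℕ), (∀ q ∈ Q₁, q.Prime) ∧ (∀ q ∈ Q₂, q.Prime) ∧ Disjoint Q₁ Q₂ ∧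
      (∀ q ∈ Q₁, ¬ q ∣ N₀) ∧ (∀ q ∈ Q₂, ¬ q ∣ N₀) ∧ N₁ = N₀ * ∏ q ∈ Q₁, q ∧ N₂ = N₀ * ∏ q ∈ Q₂, q := by
  classical
  set N₀ := Nat.gcd N₁ N₂ with hN₀
  have hN₀1 : N₀ ∣ N₁ := Nat.gcd_dvd_left N₁ N₂
  have hN₀2 : N₀ ∣ N₂ := Nat.gcd_dvd_right N₁ N₂
  have hN₀pos : 0 < N₀ := Nat.gcd_pos_of_pos_left N₂ (Nat.pos_of_ne_zero hN₁.ne_zero)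
  have hm₁ : Squarefree (N₁ / N₀) := Squarefree.squarefree_of_dvd (Nat.div_dvd_of_dvd hN₀1) hN₁
  have hm₂ : Squarefree (N₂ / N₀) := Squarefree.squarefree_of_dvd (Nat.div_dvd_of_dvd hN₀2) hN₂
  have he₁ : N₁ = N₀ * (N₁ / N₀) := (Nat.mul_div_cancel' hN₀1).symm
  have he₂ : N₂ = N₀ * (N₂ / N₀) := (Nat.mul_div_cancel' hN₀2).symm
  -- a prime of `Nᵢ/N₀` does not divide `N₀` (squarefreeness)
  have hnd : ∀ {N m : ℕ}, Squarefree N → N = N₀ * m → ∀ q ∈ m.primeFactors, ¬ q ∣ N₀ := by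
    intro N m hN hNm q hq hqN₀
    have hqp := Nat.prime_of_mem_primeFactors hq
    have hqm := Nat.dvd_of_mem_primeFactors hq
    have : q * q ∣ N := by rw [hNm]; exact mul_dvd_mul hqN₀ hqm
    exact hqp.not_isUnit (hN q this)
  refine ⟨N₀, (N₁ / N₀).primeFactors, (N₂ / N₀).primeFactors, fun q hq ↦ Nat.prime_of_mem_primeFactors hq,
    fun q hq ↦ Nat.prime_of_mem_primeFactors hq, ?_, hnd hN₁ he₁, hnd hN₂ he₂, ?_, ?_⟩
  · -- disjointness: a common prime `q` of `N₁/N₀` and `N₂/N₀` would give `q·N₀ ∣ gcd = N₀`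
    refine Finset.disjoint_left.mpr fun {q} hq₁ hq₂ ↦ ?_
    have hqp := Nat.prime_of_mem_primeFactors hq₁
    have h₁ : N₀ * q ∣ N₁ := by rw [he₁]; exact mul_dvd_mul_left N₀ (Nat.dvd_of_mem_primeFactors hq₁)
    have h₂ : N₀ * q ∣ N₂ := by rw [he₂]; exact mul_dvd_mul_left N₀ (Nat.dvd_of_mem_primeFactors hq₂)
    have h := Nat.dvd_gcd h₁ h₂
    rw [← hN₀] at h
    have hq1 : q ∣ 1 := (Nat.mul_dvd_mul_iff_left hN₀pos).mp (by simpa using h)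
    exact hqp.ne_one (Nat.dvd_one.mp hq1)
  · rw [Nat.prod_primeFactors_of_squarefree hm₁]; exact he₁
  · rw [Nat.prod_primeFactors_of_squarefree hm₂]; exact he₂

end Summit.BirchSwinnertonDyer.BirchSwinnertonDyer.Theorems.AlignedTransportAtTwoKilfordCopyCrossLevelTwoSided

end
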